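import Summits.NavierStokesRegularity.NavierStokesRegularity.Theses.PalasekTowerBreakdown
import Summits.NavierStokesRegularity.NavierStokesRegularity.Theorems.PalasekTowerBreakdownHeredityFromTwoRung
import Summits.NavierStokesRegularity.NavierStokesRegularity.Theorems.PalasekTowerBreakdownHandoverRate
import Summits.NavierStokesRegularity.NavierStokesRegularity.Theorems.PalasekTowerBreakdownHeredityWitnessUnconditional
import Summits.NavierStokesRegularity.NavierStokesRegularity.Theorems.HeredityAtOne.Negative.CappedSubfloor
import Summits.NavierStokesRegularity.NavierStokesRegularity.Theorems.HeredityAtOne.Negative.HeredityAtOneFalseWithoutFloorAtOne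
import Summits.NavierStokesRegularity.NavierStokesRegularity.Theorems.PalasekTowerBreakdownHeredityAtOneFloors
import Summits.NavierStokesRegularity.NavierStokesRegularity.Theorems.PalasekTowerBreakdownReball
import Summits.NavierStokesRegularity.FluidComputer.PalasekTowerRegisterGlobalFloorsAtSlice
import Summits.NavierStokesRegularity.NavierStokesRegularity.Theorems.HeredityAtOne.Negative.LazyEnvelopeSlice

/-!
# STRATEGY CENSUS companion for crux `HeredityAtOne` (item stmt-NavierStokesRegularity-19249)

Cell `ns-blowup`, seat `ns-palasek-19249-cstrat-1` (planner, CRUX-STRATEGIST alongside the lead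
`ns-blowup-ecbridge-1` g6 on route `PalasekTowerBreakdown`). This file is the KERNEL-CHECKED SPINE of
`Cruxes/HeredityAtOne/STRATEGY-CENSUS.md`: every logical relation the census asserts between the crux,
its registered halves, the candidate switches (transfer / strengthen / decomposition / negation) and the
tree's theorems is a `theorem` here with a real proof; the candidate switch STATEMENTS are `def`s
(hypothesis shapes, never asserted). No `sorry`, no new fact, nothing inhabited.

WHAT THIS IS NOT: not Navier–Stokes evidence — no schedule, stage, flow or tower is constructed; the crux,
its halves `AprioriCeilingAt 1` / `ReadoutFloorsAt 1`, the sibling binders and every `def` below stay OPEN.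
Nothing here asserts NS regularity or blow-up.

## Contents (section numbers = headings of STRATEGY-CENSUS.md)

* §0 the crux by name (`= HeredityAt 1`), its lossless registered halves (line `birth` v2), its four stubs
  (line `birth` v3) and the SLICE form of the lower three (p2, `readoutFloorsAt_one_iff_sliceRun`).
* §1 TRANSFER — the route's own `0 → 1` repair pattern (∃-form base after the ∀-form `FirstEpisode`
  died) transferred to `1 → 2`: the one-design door `RungG 2 → HeredityFromTwo → NavierStokesBreakdownR3`
  is a tree theorem (p445539); the binders (19179, 19249) are consumed by `closes` only through `RungG 2`;
  the crux's `∀`-surplus over designs is not load-bearing.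
* §2 STRENGTHEN — (a) the RATE form of the upper half (fc-prover-3, p447173) implies the registered stub,
  not conversely; (b) the uniform-in-`k` form is the parent; (c) VACUITY (`NoLevelOne`) proves the crux and
  kills the sibling binder; (d) the CRITICAL-AMPLIFIER RIGIDITY schema `LevelOneSelects D ∧ HeredityAtOneOn D`;
  (e) the DESIGN-FREE slice heredity `SliceHeredityAtOne` on the level-1 envelope (letter + ceiling kept,
  registration stripped): implies the lower stubs, feeds the crux with the upper stub, and has a
  VACUITY-FREE refutation template (no registered stage needed).
* §3 DECOMPOSITION — the schema of §2(d) is the only typed split beyond the registered stubs; its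
  selection piece carries the whole `∀`; the BALL LEVER (fc-prover-3) by name: the crux as typed confines
  the level-2 readout to every admissible ball.
* §4 NEGATION — every refutation witnesses the sibling (`EpisodeBase`); the binders cannot both fail;
  the levers of record (`CappedStageAtOne`, `SubfloorStageAt 1`, the escaping-extension template) by name;
  (b) the disprover's load-bearing analysis `heredityAtOne_false_without_floorAtOne`.

References: S. Palasek, arXiv:2605.13827 §3–§4 [cite: Palasek2026ElementaryModel, §4];
C. L. Fefferman, Clay problem description (C) [cite: FeffermanClay2006, (C)]; T. Gallay, V. Šverák,
Confluentes Math. 7 (2015) 67–95, Lemma 5.1 [cite: GallaySverak2016, Lemma 5.1 (arXiv p. 16)]; H. Sohr, *The Navier–Stokes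
Equations*, Birkhäuser 2001, Ch. V Thm. 1.5.1 [cite: Sohr2001, Ch. V Thm. 1.5.1].
-/

noncomputable section

namespace Summit.NavierStokesRegularity.NavierStokesRegularity.Cruxes.HeredityAtOne.StrategyCensus

open Set MeasureTheory Filter Topology
open scoped ENNReal RealInnerProductSpace
open Summit.NavierStokesRegularity.NavierStokesRegularity.Theses
open Summit.NavierStokesRegularity.NavierStokesRegularity.Theorems
open Summit.NavierStokesRegularity.FluidComputer.PalasekTowerClayBridge
open Summit.NavierStokesRegularity.HeredityAtOneSpeedCap
open Literature.Analysis.FluidPDE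

/-! ## §0 The crux by name and its registered halves -/

/-- The route decl IS heredity at level `1` of the v2.3′ register. [folklore] -/
theorem crux_iff_heredityAt_one : PalasekTowerBreakdown.HeredityAtOne ↔ HeredityAt 1 :=
  heredityAtOne_iff

/-- The registered line `birth` v2 is LOSSLESS: crux ↔ upper half ∧ lower half (p443802). [folklore] -/
theorem crux_iff_halves : PalasekTowerBreakdown.HeredityAtOne ↔ AprioriCeilingAt 1 ∧ ReadoutFloorsAt 1 :=
  palasekTowerBreakdown_heredityAtOne_iff_apriori_floors

/-- The crux as a statement about DESIGNS: every pinned rigid quiet wide design reaching level `1`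
reaches level `2` (p427615/p432407 lineage). [folklore] -/
theorem crux_iff_forall_designs :
    PalasekTowerBreakdown.HeredityAtOne ↔
      ∀ S : Schedule TowerRates.wide, S.Pins 8 (6 / 5) → S.Rigid → S.Quiet →
        Nonempty (Stage 1 TowerRates.wide S (Margins.routeG TowerRates.wide) 1) →
          Nonempty (Stage 1 TowerRates.wide S (Margins.routeG TowerRates.wide) 2) :=
  palasekTowerBreakdown_heredityAtOne_iff_nonempty_two

/-- §0(c) The crux ⇔ its FOUR registered stubs (line `birth` v3, p453414 / p452333): no overshoot on the
window + the three level-2 floors (speed, strain, core), each a `∀` over registered level-1 stages.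
[cite: Palasek2026ElementaryModel, §4] -/
theorem crux_iff_four_stubs :
    PalasekTowerBreakdown.HeredityAtOne ↔
      AprioriCeilingAt 1 ∧ SpeedFloorAt 1 ∧ StrainFloorAt 1 ∧ CoreFloorAt 1 :=
  palasekTowerBreakdown_heredityAtOne_iff_apriori_speed_strain_core

/-- §0(d) The lower three stubs are a property of the level-1 SLICE (p2, `readoutFloorsAt_one_iff_sliceRun`):
every tame FREE Navier–Stokes run of length `τ₂ − τ₁` from the slice `s.u τ₁` of every registered level-1
stage, inside the ceiling `c₂ Y₂`, ends with the level-2 letter in the ball. The forced history `[0, τ₁]`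
enters only through WHICH slices are registered. [cite: Palasek2026ElementaryModel, §4] -/
theorem floors_iff_sliceRun_on_registered_slices :
    ReadoutFloorsAt 1 ↔
      ∀ S : Schedule TowerRates.wide, S.Pins 8 (6 / 5) → S.Rigid → S.Quiet →
        ∀ s : Stage 1 TowerRates.wide S (Margins.routeG TowerRates.wide) 1,
          SliceRun S 1 (fun S v => Letter S 2 v) (s.u (S.τ 1)) :=
  readoutFloorsAt_one_iff_sliceRun

/-! ## §1 TRANSFER — the one-design (`∃`) door: the `∀`-surplus of the crux is not load-bearing -/

/-- **What `closes` actually consumes of the binders 19179 ∧ 19249: the rung `RungG 2`** (one pinned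
rigid quiet wide design with a registered level-`2` stage). [folklore] -/
theorem rungG_two_of_binders (h₁ : PalasekTowerBreakdown.EpisodeBase)
    (h₂ : PalasekTowerBreakdown.HeredityAtOne) : RungG 2 :=
  rungG_two_of_heredityAtOne h₁ h₂

/-- **The ∃-door is a tree theorem** (19250-p1, p445539): `RungG 2` and the child binder 19250 already
decide the sub-problem statement. [cite: FeffermanClay2006, (C)] -/
theorem breakdownR3_of_rungG_two (h : RungG 2) (h₃ : PalasekTowerBreakdown.HeredityFromTwo) :
    NavierStokesBreakdownR3 :=
  palasekTowerBreakdown_breakdownR3_of_heredityFromTwo_rungG h₃ ⟨2, le_rfl, h⟩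

/-- Hence the route's deciding composition factors through the door: the three binders give the
statement with 19179 ∧ 19249 used ONLY to manufacture `RungG 2`. [cite: FeffermanClay2006, (C)] -/
theorem breakdownR3_of_binders_via_door (h₁ : PalasekTowerBreakdown.EpisodeBase)
    (h₂ : PalasekTowerBreakdown.HeredityAtOne) (h₃ : PalasekTowerBreakdown.HeredityFromTwo) :
    NavierStokesBreakdownR3 :=
  breakdownR3_of_rungG_two (rungG_two_of_binders h₁ h₂) h₃

/-- `RungG 2` sits on the `∃` side: it returns the base binder … [folklore] -/
theorem episodeBase_of_rungG_two (h : RungG 2) : PalasekTowerBreakdown.EpisodeBase :=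
  h.episodeBaseG (by norm_num)

/-- … and it is exactly «SOME design reaching level 1 reaches level 2» — ONE instance of the crux's
`∀` over designs (compare `crux_iff_forall_designs`). [folklore] -/
theorem rungG_two_iff_exists_design :
    RungG 2 ↔ ∃ S : Schedule TowerRates.wide, S.Pins 8 (6 / 5) ∧ S.Rigid ∧ S.Quiet ∧
      Nonempty (Stage 1 TowerRates.wide S (Margins.routeG TowerRates.wide) 1) ∧
        Nonempty (Stage 1 TowerRates.wide S (Margins.routeG TowerRates.wide) 2) := by
  constructor
  · rintro ⟨S, hP, hR, hQ, ⟨s⟩⟩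
    exact ⟨S, hP, hR, hQ, ⟨s.restrictOfAntitone (Margins.antitone_routeG TowerRates.wide) (by norm_num)⟩,
      ⟨s⟩⟩
  · rintro ⟨S, hP, hR, hQ, -, h2⟩
    exact ⟨S, hP, hR, hQ, h2⟩

/-! ## §2 STRENGTHEN — the candidate stronger forms, each placed against the registered stubs -/

/-- **(a) RATE FORM of the upper half** (fc-prover-3 g3, `aprioriCeilingAt_of_pressureRate`): at every
running global speed maximum in the band `((5/3)·Y₁, (5/3)·Y₂]` of every finite-energy classical
continuation of every registered level-1 stage, the pressure push is slower than the mean hand-over rate,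
`−⟪u, ∇p⟫ < |Du|²_F + (5/3)(Y₂ − Y₁)/(τ₂ − τ₁) · ‖u‖`. HYPOTHESIS SHAPE, never asserted.
[cite: Palasek2026ElementaryModel, §4] -/
@[conjecture] def PressureRateAtOne : Prop :=
  ∀ S : Schedule TowerRates.wide, S.Pins 8 (6 / 5) → S.Rigid → S.Quiet →
    ∀ s : Stage 1 TowerRates.wide S (Margins.routeG TowerRates.wide) 1,
    ∀ T' ∈ Icc (S.τ 1) (S.τ (1 + 1)),
    ∀ (u : ℝ → EuclideanSpace ℝ (Fin 3) → EuclideanSpace ℝ (Fin 3))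
      (p : ℝ → EuclideanSpace ℝ (Fin 3) → ℝ),
      IsClassicalNSSolutionOn (Icc 0 T') 1 S.f u p →
      (∀ t ∈ Icc 0 (S.τ 1), u t = s.u t ∧ p t = s.p t) →
      (∃ C : ℝ≥0∞, C < ⊤ ∧ ∀ t ∈ Icc 0 T', ∫⁻ x, ‖u t x‖ₑ ^ 2 ≤ C) →
      ∀ t ∈ Ioc (S.τ 1) T', ∀ x : EuclideanSpace ℝ (Fin 3),
        (∀ y, ‖u t y‖ ≤ ‖u t x‖) →
        S.c₂ * TowerRates.wide.Y 1 < ‖u t x‖ → ‖u t x‖ ≤ S.c₂ * TowerRates.wide.Y (1 + 1) →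
        (∀ t' ∈ Ico 0 t, ∀ y, ‖u t' y‖ < ‖u t x‖) →
        - ⟪u t x, gradient (p t) x⟫ < frobeniusNormSq (fderiv ℝ (u t) x) +
          (S.c₂ * TowerRates.wide.Y (1 + 1) - S.c₂ * TowerRates.wide.Y 1) / (S.τ (1 + 1) - S.τ 1) *
            ‖u t x‖

/-- The rate form IMPLIES the registered upper stub (so a rate-form line replaces `AprioriCeilingAt 1`
by a STRONGER stub; it dodges nothing). [cite: Palasek2026ElementaryModel, §4] -/
theorem aprioriCeilingAt_one_of_pressureRateAtOne (h : PressureRateAtOne) : AprioriCeilingAt 1 :=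
  aprioriCeilingAt_of_pressureRate le_rfl h

/-- The rate-form composition to the crux BY NAME (fc-prover-3's
`palasekTowerBreakdown_heredityAtOne_of_pressureRate_floors`). [cite: Palasek2026ElementaryModel, §4] -/
theorem crux_of_pressureRateAtOne_floors (h : PressureRateAtOne) (hF : ReadoutFloorsAt 1) :
    PalasekTowerBreakdown.HeredityAtOne :=
  palasekTowerBreakdown_heredityAtOne_of_pressureRate_floors h hF

/-- **(b) UNIFORM-IN-`k` FORM = the parent**: `HeredityFrom 1` (K2G verbatim) gives the crux by
instantiation — a one-stub «line» on it restates the split parent 19178 (costume). [folklore] -/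
theorem crux_of_heredityFrom_one (h : HeredityFrom 1) : PalasekTowerBreakdown.HeredityAtOne :=
  heredityAtOne_iff.2 (h.heredityAt le_rfl)

/-- **(c) VACUITY**: no pinned rigid quiet wide design registers a level-1 stage. HYPOTHESIS SHAPE,
never asserted (its content is a universal bound on free sup-speed amplification, census §2(c)).
[cite: Palasek2026ElementaryModel, §4] -/
@[conjecture] def NoLevelOne : Prop :=
  ∀ S : Schedule TowerRates.wide, S.Pins 8 (6 / 5) → S.Rigid → S.Quiet →
    IsEmpty (Stage 1 TowerRates.wide S (Margins.routeG TowerRates.wide) 1)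

/-- Vacuity proves the crux … [folklore] -/
theorem crux_of_noLevelOne (h : NoLevelOne) : PalasekTowerBreakdown.HeredityAtOne :=
  heredityAtOne_iff.2 fun S hP hR hQ s => ((h S hP hR hQ).false s).elim

/-- … and refutes the sibling binder 19179 (`EpisodeBase`): a vacuity line closes the crux by killing
the route. [folklore] -/
theorem not_episodeBase_of_noLevelOne (h : NoLevelOne) : ¬ PalasekTowerBreakdown.EpisodeBase :=
  fun ⟨S, hP, hR, hQ, ⟨s⟩⟩ => (h S hP hR hQ).false s

/-- Conversely vacuity is EXACTLY the failure of the sibling: `NoLevelOne ↔ ¬ EpisodeBase`. [folklore] -/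
theorem noLevelOne_iff_not_episodeBase : NoLevelOne ↔ ¬ PalasekTowerBreakdown.EpisodeBase := by
  refine ⟨not_episodeBase_of_noLevelOne, fun h S hP hR hQ => ⟨fun s => h ⟨S, hP, hR, hQ, ⟨s⟩⟩⟩⟩

/-- **(d) CRITICAL-AMPLIFIER RIGIDITY, selection piece**: every registered level-1 stage of every pinned
rigid quiet wide design lies in the class `D` (intended `D`: «the `τ₁`-slice is, near its speed maximum,
`ε`-close to a member of a compact family of near-extremal amplifier profiles»). HYPOTHESIS SCHEMA over
an abstract class `D`, never asserted. [cite: Palasek2026ElementaryModel, §4] -/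
@[conjecture] def LevelOneSelects
    (D : ∀ S : Schedule TowerRates.wide, Stage 1 TowerRates.wide S (Margins.routeG TowerRates.wide) 1 → Prop) :
    Prop :=
  ∀ S : Schedule TowerRates.wide, S.Pins 8 (6 / 5) → S.Rigid → S.Quiet →
    ∀ s : Stage 1 TowerRates.wide S (Margins.routeG TowerRates.wide) 1, D S s

/-- **(d) CRITICAL-AMPLIFIER RIGIDITY, hand-over piece**: heredity at level `1` RESTRICTED to the class
`D`. HYPOTHESIS SCHEMA, never asserted. [cite: Palasek2026ElementaryModel, §4] -/
@[conjecture] def HeredityAtOneOn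
    (D : ∀ S : Schedule TowerRates.wide, Stage 1 TowerRates.wide S (Margins.routeG TowerRates.wide) 1 → Prop) :
    Prop :=
  ∀ S : Schedule TowerRates.wide, S.Pins 8 (6 / 5) → S.Rigid → S.Quiet →
    ∀ s : Stage 1 TowerRates.wide S (Margins.routeG TowerRates.wide) 1, D S s →
      ∃ s' : Stage 1 TowerRates.wide S (Margins.routeG TowerRates.wide) 2, s.Extends s'

/-- The schema composes to the crux BY NAME for every class `D` (the `_of_subs` shape of a 2-piece split).
[folklore] -/
theorem crux_of_selects
    (D : ∀ S : Schedule TowerRates.wide, Stage 1 TowerRates.wide S (Margins.routeG TowerRates.wide) 1 → Prop)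
    (h₁ : LevelOneSelects D) (h₂ : HeredityAtOneOn D) : PalasekTowerBreakdown.HeredityAtOne :=
  heredityAtOne_iff.2 fun S hP hR hQ s => h₂ S hP hR hQ s (h₁ S hP hR hQ s)

/-- The hand-over piece is a CONSEQUENCE of the crux for every `D` (so it is never «too strong») …
[folklore] -/
theorem heredityAtOneOn_of_crux
    (D : ∀ S : Schedule TowerRates.wide, Stage 1 TowerRates.wide S (Margins.routeG TowerRates.wide) 1 → Prop)
    (h : PalasekTowerBreakdown.HeredityAtOne) : HeredityAtOneOn D :=
  fun S hP hR hQ s _ => heredityAtOne_iff.1 h S hP hR hQ s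

/-- … and with the trivial class the hand-over piece IS the crux: the split has content only through the
selection piece `LevelOneSelects D`, which carries the crux's whole `∀` over designs. [folklore] -/
theorem heredityAtOneOn_top_iff :
    HeredityAtOneOn (fun _ _ => True) ↔ PalasekTowerBreakdown.HeredityAtOne :=
  ⟨fun h => crux_of_selects _ (fun _ _ _ _ _ => trivial) h, heredityAtOneOn_of_crux _⟩

/-! ## §4 NEGATION — every refutation witnesses the sibling; the levers of record by name -/

/-- **A refutation of the crux PROVES the sibling binder 19179** (p439748): the counterexample's design
and registered level-1 stage inhabit `EpisodeBase = RungG 1`. [folklore] -/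
theorem episodeBase_of_not_crux (h : ¬ PalasekTowerBreakdown.HeredityAtOne) :
    PalasekTowerBreakdown.EpisodeBase :=
  episodeBaseG_of_not_heredityAtOne h

/-- Hence the two binders 19179, 19249 are never both false. [folklore] -/
theorem crux_or_episodeBase : PalasekTowerBreakdown.HeredityAtOne ∨ PalasekTowerBreakdown.EpisodeBase :=
  heredityAtOne_or_episodeBaseG

/-- **Lever of record (disprove-1, p448312)**: a capped registered level-1 stage refutes the crux.
[cite: Palasek2026ElementaryModel, §4] -/
theorem not_crux_of_cappedStageAtOne (h : CappedStageAtOne) : ¬ PalasekTowerBreakdown.HeredityAtOne :=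
  HeredityAtOne_false_of_CappedStageAtOne h

/-- **Lever of record (refuter g12 KJ-14/KJ-15, p454111 lineage)**: the STALLER — one registered level-1
stage plus one finite-energy classical solution of the design's system to `τ₂` with sub-floor speed on the
readout ball — refutes the crux; the cap lever factors through it. [cite: Palasek2026ElementaryModel, §4] -/
theorem not_crux_of_subfloorStageAt_one (h : SubfloorStageAt 1) : ¬ PalasekTowerBreakdown.HeredityAtOne :=
  heredityAtOne_false_of_subfloorStageAtOne h

/-- Any staller already CARRIES a registered level-1 stage, i.e. proves the sibling binder: the negation
side of the crux is at least as hard as item 19179. [folklore] -/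
theorem episodeBase_of_subfloorStageAt_one (h : SubfloorStageAt 1) : PalasekTowerBreakdown.EpisodeBase :=
  episodeBase_of_not_crux (not_crux_of_subfloorStageAt_one h)

/-! ## §2(e) STRENGTHEN, design-free — SLICE HEREDITY on the level-1 ENVELOPE (registration stripped,
floors and ceiling kept): the one strengthening whose refutation needs NO registered stage -/

/-- The level-1 ENVELOPE of a design: velocity slices carrying the level-1 LETTER (speed floor `c₁ Y₁`,
strain floor `c₁ A₁`, an `N₁`-core loop, all read in `B̄(0, radius)`) and the level-1 CEILING `c₂ Y₁`
everywhere. Every registered level-1 slice lies in it (`sliceEnvelopeOne_of_stage`); which other fields do is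
irrelevant to the crux but decisive for the strengthening below. [cite: Palasek2026ElementaryModel, §3.1] -/
def SliceEnvelopeOne (S : Schedule TowerRates.wide)
    (v : EuclideanSpace ℝ (Fin 3) → EuclideanSpace ℝ (Fin 3)) : Prop :=
  Letter S 1 v ∧ ∀ x, ‖v x‖ ≤ S.c₂ * TowerRates.wide.Y 1

/-- **S⁺ = SLICE HEREDITY AT ONE (design-free).** For every pinned rigid quiet wide design and EVERY slice `v`
in its level-1 envelope (not only registered ones): every unforced finite-energy classical run of length
`τ₂ − τ₁` from `v` that stays inside the ceiling `c₂ Y₂` ends with the level-2 letter in the ball. Strictly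
between the disprover's `HeredityAtWithoutFloor 1` (floors stripped — FALSE, zero design, p-lane
`heredityAtOne_false_without_floorAtOne`) and the crux (registration kept). CANDIDATE, never asserted; the
census files it as the vacuity-free refutation target (`HeredityAtOne_false_without_History`).
[cite: Palasek2026ElementaryModel, §4] -/
@[conjecture] def SliceHeredityAtOne : Prop :=
  ∀ S : Schedule TowerRates.wide, S.Pins 8 (6 / 5) → S.Rigid → S.Quiet →
    ∀ v : EuclideanSpace ℝ (Fin 3) → EuclideanSpace ℝ (Fin 3), SliceEnvelopeOne S v →
      SliceRun S 1 (fun S w => Letter S 2 w) v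

/-- Every registered level-1 slice lies in the level-1 envelope (floor, strain, core: `Letter.of_stage`;
ceiling: the stage's own `ceiling` clause at `t = τ₁`). [cite: Palasek2026ElementaryModel, §3.1] -/
theorem sliceEnvelopeOne_of_stage {S : Schedule TowerRates.wide}
    (s : Stage 1 TowerRates.wide S (Margins.routeG TowerRates.wide) 1) : SliceEnvelopeOne S (s.u (S.τ 1)) :=
  ⟨Letter.of_stage s le_rfl, fun x => s.ceiling 1 le_rfl (S.τ 1) ⟨(S.τ_pos 1).le, le_rfl⟩ x⟩

/-- **S⁺ ⇒ the lower three stubs** (via the slice form of the floors). [cite: Palasek2026ElementaryModel, §4] -/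
theorem readoutFloorsAt_one_of_sliceHeredityAtOne (h : SliceHeredityAtOne) : ReadoutFloorsAt 1 :=
  readoutFloorsAt_one_iff_sliceRun.2 fun S hP hR hQ s => h S hP hR hQ _ (sliceEnvelopeOne_of_stage s)

/-- **S⁺ + the upper stub ⇒ the crux.** The strengthening feeds the registered composition unchanged.
[cite: Palasek2026ElementaryModel, §4] -/
theorem crux_of_apriori_sliceHeredityAtOne (hA : AprioriCeilingAt 1) (h : SliceHeredityAtOne) :
    PalasekTowerBreakdown.HeredityAtOne :=
  crux_iff_halves.2 ⟨hA, readoutFloorsAt_one_of_sliceHeredityAtOne h⟩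

/-- **The vacuity-free refutation template for S⁺.** ONE pinned rigid quiet wide design, ONE envelope slice
`v` (it need NOT be registered — no stage, no forced history, no item-19179 content), and ONE unforced
finite-energy classical run of length `τ₂ − τ₁` from `v` inside the ceiling `c₂ Y₂` whose terminal slice is
NOT a level-2 letter in the ball, refute `SliceHeredityAtOne`. (Census: a swirl-free Hill-type slice meeting
the level-1 letter, capped below `c₁ Y₂` by an EXPLICIT-constant Gallay–Šverák bound, is the cheapest
candidate; the tree's `VelocitySupBound` is `∃ C` only.) [cite: GallaySverak2016, Lemma 5.1 (arXiv p. 16)] -/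
theorem not_sliceHeredityAtOne_of_lazy_envelope_slice
    (hW : ∃ (S : Schedule TowerRates.wide) (v : EuclideanSpace ℝ (Fin 3) → EuclideanSpace ℝ (Fin 3))
      (w : ℝ → EuclideanSpace ℝ (Fin 3) → EuclideanSpace ℝ (Fin 3)) (r : ℝ → EuclideanSpace ℝ (Fin 3) → ℝ),
      S.Pins 8 (6 / 5) ∧ S.Rigid ∧ S.Quiet ∧ SliceEnvelopeOne S v ∧
      IsClassicalNSSolutionOn (Icc 0 (S.τ 2 - S.τ 1)) 1 0 w r ∧ w 0 = v ∧
      (∃ C : ℝ≥0∞, C < ⊤ ∧ ∀ σ ∈ Icc 0 (S.τ 2 - S.τ 1), ∫⁻ x, ‖w σ x‖ₑ ^ 2 ≤ C) ∧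
      (∀ σ ∈ Icc 0 (S.τ 2 - S.τ 1), ∀ x, ‖w σ x‖ ≤ S.c₂ * TowerRates.wide.Y 2) ∧
      ¬ Letter S 2 (w (S.τ 2 - S.τ 1))) :
    ¬ SliceHeredityAtOne := by
  intro h
  obtain ⟨S, v, w, r, hP, hR, hQ, hv, hw, hw0, hE, hB, hnot⟩ := hW
  exact hnot (h S hP hR hQ v hv w r hw hw0 hE hB)

/-- **S⁺ IS REFUTED — census §Strengthen (e) SETTLED (tenure planner ns-blowup-plan g21, 2026-08-27).** The lazy
envelope slice of `Theorems/HeredityAtOne/Negative/LazyEnvelopeSlice.lean` (fc-prover-3 g6, p484570: a smoothed Hill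
spherical vortex `hillField 3.92e8 (1/216) (1/210)` meeting the level-1 letter inside the ceiling on the pinned rigid
quiet `lazyDesign`, whose unforced tame finite-energy run stays below `c₂ Y₂` and misses the level-2 letter) instantiates
the template above verbatim (refuter4 K101 by-name probe, std axioms; disprove-1's `RestDesign` route composes too).
What this records: any proof of the crux `HeredityAtOne` must use registration of the level-1 slice beyond
letter + ceiling (`lazy_envelope_slice_not_registered` below); the crux itself is untouched. -/
theorem not_sliceHeredityAtOne : ¬ SliceHeredityAtOne :=
  not_sliceHeredityAtOne_of_lazy_envelope_slice HeredityAtOneLazySlice.exists_lazy_envelope_slice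

/-- Conversely a refutation of S⁺ does NOT refute the crux: it only shows that any proof of `HeredityAtOne`
must use more about registered level-1 slices than the envelope (letter + ceiling at `τ₁`) — recorded as the
implication «crux ∧ ¬S⁺ ⇒ some envelope slice is never registered-and-lazy», i.e. the registered slices form a
PROPER dynamical sub-class of the envelope. Typed as: under the crux, an envelope slice with a lazy tame run
is not the `τ₁`-slice of any registered level-1 stage. [cite: Palasek2026ElementaryModel, §4] -/
theorem lazy_envelope_slice_not_registered (h : PalasekTowerBreakdown.HeredityAtOne)
    {S : Schedule TowerRates.wide} (hP : S.Pins 8 (6 / 5)) (hR : S.Rigid) (hQ : S.Quiet)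
    {v : EuclideanSpace ℝ (Fin 3) → EuclideanSpace ℝ (Fin 3)}
    (hlazy : ¬ SliceRun S 1 (fun S w => Letter S 2 w) v)
    (s : Stage 1 TowerRates.wide S (Margins.routeG TowerRates.wide) 1) : s.u (S.τ 1) ≠ v := by
  intro hs
  have hF : ReadoutFloorsAt 1 := (crux_iff_halves.1 h).2
  exact hlazy (hs ▸ readoutFloorsAt_one_iff_sliceRun.1 hF S hP hR hQ s)

/-! ## §3 DECOMPOSITION — the BALL LEVER by name (fc-prover-3 g4, p457497 / p457722; re-centred p-Recentre):
the conclusion-side ball is the cheapest misstatement risk of every `∀`-floor stub -/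

/-- **The crux as typed confines the level-2 readout**: under `HeredityAtOne`, a registered level-2 stage of a
pinned rigid quiet wide design whose levels `0, 1` are read inside an admissible ball `B̄(0, r)` (`r ≤ radius`,
confining datum and force) reads level `2` — speed `≥ c₁ Y₂`, strain `≥ c₁ A₂`, an `N₂`-core — inside the SAME
ball, although the active structure drifts `≈ c₅ log N₂ / N₁ ≈ 0.153 ≫ 1/N₁` across the window at floor speed.
[cite: Sohr2001, Ch. V Thm. 1.5.1] -/
theorem crux_confines_level_two_readout (h : PalasekTowerBreakdown.HeredityAtOne)
    {S : Schedule TowerRates.wide} (hP : S.Pins 8 (6 / 5)) (hR : S.Rigid) (hQ : S.Quiet)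
    (s'' : Stage 1 TowerRates.wide S (Margins.routeG TowerRates.wide) 2) {r : ℝ} (hr : r ≤ S.radius)
    (hc : S.ConfinedTo r) (hs : ∀ j, j ≤ 1 → S.ReadsIn j r (s''.u (S.τ j))) :
    S.ReadsIn 2 r (s''.u (S.τ 2)) :=
  palasekTowerBreakdown_heredityAtOne_readsIn_reball' h hP hR hQ s'' hr hc hs

/-- **The ball-lever refutation template (stage form), by name.** ONE registered level-1 stage, ONE admissible
ball, and NO registered level-2 extension reading level 2 inside it ⇒ `¬ HeredityAtOne`. Vacuity warning as
for every template: the premise needs a registered level-1 stage (item 19179). [cite: Palasek2026ElementaryModel, §4] -/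
theorem not_crux_of_escaping_extension {S : Schedule TowerRates.wide}
    (hP : S.Pins 8 (6 / 5)) (hR : S.Rigid) (hQ : S.Quiet)
    (s : Stage 1 TowerRates.wide S (Margins.routeG TowerRates.wide) 1) {r : ℝ} (hr : r ≤ S.radius)
    (hc : S.ConfinedTo r) (hs : ∀ j, j ≤ 1 → S.ReadsIn j r (s.u (S.τ j)))
    (hesc : ∀ s' : Stage 1 TowerRates.wide S (Margins.routeG TowerRates.wide) 2, s.Extends s' →
      ¬ S.ReadsIn 2 r (s'.u (S.τ 2))) :
    ¬ PalasekTowerBreakdown.HeredityAtOne :=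
  palasekTowerBreakdown_not_heredityAtOne_of_not_readsIn hP hR hQ s hr hc hs hesc

/-! ## §4(b) NEGATION, load-bearing analysis of record (disprove-1): the FLOOR is load-bearing -/

/-- **Any proof must use the level-1 floor** (disprove-1, `heredityAtOne_false_without_floorAtOne`): heredity
with the level-1 registration stripped to «classical, from `S.u₀`, finite energy, under the ceiling» is FALSE
(rest state on the zero design). The census's S⁺ (`SliceHeredityAtOne`) is the next rung of this ladder:
floors KEPT, history stripped. [cite: Sohr2001, Ch. V Thm. 1.5.1] -/
theorem any_proof_uses_the_floor : ¬ HeredityAtOneZeroDesign.HeredityAtWithoutFloor 1 :=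
  HeredityAtOneZeroDesign.heredityAtOne_false_without_floorAtOne

end Summit.NavierStokesRegularity.NavierStokesRegularity.Cruxes.HeredityAtOne.StrategyCensus

end
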